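import Summits.ResolutionOfSingularities.ResolutionOfSingularities.Theorems.EquisingularLiftEquisingularLiftNatSpecimenCuspConeAlgebra
import HarnessLib

/-!
# [OURS · L1 W4.5(b) · EL♮(3)] NOSE ENGINE CERTIFICATION ‖ K, specimen 3 — CAYLEY'S RULED CUBIC `x₀x₂² + x₁x₂x₃ + x₃³`: the polynomial algebra
# (chart equations, four strict-transform charts, two smooth charts, primes; every field, every characteristic)

Cell `res-hironaka`, slot W4.5(b); crux **EL♮(3)** (stmt-ResolutionOfSingularities-20148); width seat res-L1-w45b-nose-w3, row «NOSE ENGINE CERT ‖ K» of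
res-L1-w45b-plan-1's WIDTH TABLE D1′. `--supports stmt-ResolutionOfSingularities-20148 --as helper`; closes nothing. OURS; NOT a statement of any
manuscript; AI-written, weaker than expert review. Eight small `def`s (chart equations), no `sorry`, standard axioms. No local instances.

The specimen: `H = V₊(x₀x₂² + x₁x₂x₃ + x₃³) ⊂ ℙ³_k` — CAYLEY'S RULED CUBIC, the second projective type of cubic scroll with a double line (R2's Whitney-type
cubic is the first): singular along `Σ = V(x₂, x₃)` with transversal type `A₁` at `[a:b:0:0]`, `b ≠ 0` (`a x₂² + b x₂x₃ + …`) and ONE cusp-pinch at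
`[1:0:0:0]` (`x₂² + x₃³`). Chart equations (`y` = the other variables in order): `g₀ = y₁² + y₀y₁y₂ + y₂³`, `g₁ = y₀y₁² + y₁y₂ + y₂³` (centre `(y₁, y₂)`),
`g₂ = y₀ + y₁y₂ + y₂³`, `g₃ = y₀y₂² + y₁y₂ + 1` (centre `(1)`). This is the POLYNOMIAL input of the generic double-line files (`CuspCone.isRegularRing_strictTransformChart`
p643466, `DoubleLine.isRegular_of_isBlowup_comap_vanishingIdeal` p645742, `DoubleLine.reachNoseTowerBTriplePrime_of_isRegular_blowups` p645692):

* the four strict-transform charts `isRegularRing_chart₀₁/₀₂/₁₁/₁₂`: `1 + y₀y₂ + y₁y₂³` (`∂₀ = y₂`, a unit), `y₁² + y₀y₁ + y₂` (`∂₂ = 1`),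
  `y₀ + y₂ + y₁y₂³` (`∂₀ = 1`), `y₀y₁² + y₁ + y₂` (`∂₂ = 1`);
* the two smooth charts `isRegularRing_quotient_g₂/g₃` (`∂₀ g₂ = 1`; `∂₁ g₃ = y₂`, a unit) and their radical ideals;
* `prime_g₀` (degree one in `y₀`, coefficient `y₁y₂` relatively prime to `y₁² + y₂³`), `prime_g₁` (degree one in `y₀`, coefficient `y₁²` vs `y₁y₂ + y₂³`).

References: A. Cayley, *A memoir on cubic surfaces*, Phil. Trans. 159 (1869) (the cubic scrolls); Görtz–Wedhorn Prop. 13.96 — through the cited tree files.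
-/

set_option linter.dupNamespace false -- mandated namespace `Summit.<Summit>.<Problem>` of this single-conjunct summit

noncomputable section

open MvPolynomial
open Literature.AlgebraicGeometry.Resolution

namespace Summit.ResolutionOfSingularities.ResolutionOfSingularities.Cruxes.EquisingularLiftNat.Sections

namespace CayleyRuled

variable (k : Type) [Field k]

/-! ## The chart equations and their strict transforms -/

/-- `g₀ = y₁² + y₀y₁y₂ + y₂³`: the chart `D₊(x₀)` (`y = (x₁, x₂, x₃)`). [folklore] -/
def g₀ : MvPolynomial (Fin 3) k := X 1 ^ 2 + X 0 * X 1 * X 2 + X 2 ^ 3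

/-- `g₁ = y₀y₁² + y₁y₂ + y₂³`: the chart `D₊(x₁)` (`y = (x₀, x₂, x₃)`; contains the cusp-pinch `y = 0`). [folklore] -/
def g₁ : MvPolynomial (Fin 3) k := X 0 * X 1 ^ 2 + X 1 * X 2 + X 2 ^ 3

/-- `g₂ = y₀ + y₁y₂ + y₂³`: the chart `D₊(x₂)` (`y = (x₀, x₁, x₃)`), off the double line. [folklore] -/
def g₂ : MvPolynomial (Fin 3) k := X 0 + X 1 * X 2 + X 2 ^ 3

/-- `g₃ = y₀y₂² + y₁y₂ + 1`: the chart `D₊(x₃)` (`y = (x₀, x₁, x₂)`), off the double line. [folklore] -/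
def g₃ : MvPolynomial (Fin 3) k := X 0 * X 2 ^ 2 + X 1 * X 2 + 1

/-- The strict transform `1 + y₀y₂ + y₁y₂³` of `g₀` on the chart `b = y₁` (`y₂ ↦ y₁y₂`). [folklore] -/
def g₀' : MvPolynomial (Fin 3) k := 1 + X 0 * X 2 + X 1 * X 2 ^ 3

/-- The strict transform `y₁² + y₀y₁ + y₂` of `g₀` on the chart `b = y₂` (`y₁ ↦ y₂y₁`). [folklore] -/
def g₀'' : MvPolynomial (Fin 3) k := X 1 ^ 2 + X 0 * X 1 + X 2

/-- The strict transform `y₀ + y₂ + y₁y₂³` of `g₁` on the chart `b = y₁`. [folklore] -/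
def g₁' : MvPolynomial (Fin 3) k := X 0 + X 2 + X 1 * X 2 ^ 3

/-- The strict transform `y₀y₁² + y₁ + y₂` of `g₁` on the chart `b = y₂`. [folklore] -/
def g₁'' : MvPolynomial (Fin 3) k := X 0 * X 1 ^ 2 + X 1 + X 2

/-! ## The four strict-transform charts of the double line -/

/-- **Chart `c = 0`, `b = y₁`**: `g₀ ↦ y₁²·(1 + y₀y₂ + y₁y₂³)`; `∂₀ = y₂` is a unit modulo the strict transform (`y₂·(−y₀ − y₁y₂²) ≡ 1`). [folklore] -/
theorem isRegularRing_chart₀₁ :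
    IsRegularRing (blowupAlgebra ((Ideal.span (X '' CuspCone.cenVars)).map (Ideal.Quotient.mk (Ideal.span {g₀ k})))
      (Ideal.Quotient.mk (Ideal.span {g₀ k}) (X 1 : MvPolynomial (Fin 3) k))) := by
  obtain ⟨h0, h1, h2⟩ := CuspCone.subst₁_X k
  refine CuspCone.isRegularRing_strictTransformChart k (g₀ k) (g₀' k) 1 2 ?_ ?_ ?_
  · simp only [g₀, g₀', map_add, map_mul, map_pow, h0, h1, h2]
    ring
  · rintro ⟨q, hq⟩
    have h := congrArg (MvPolynomial.eval ![(0 : k), 0, 0]) hq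
    simp [g₀'] at h
  · refine isRegularRing_quotient_of_derivation (g₀' k) (pderiv 0 : Derivation k (MvPolynomial (Fin 3) k) (MvPolynomial (Fin 3) k)) ?_
    have h : (pderiv 0 : Derivation k (MvPolynomial (Fin 3) k) (MvPolynomial (Fin 3) k)) (g₀' k) = X 2 := by
      simp [g₀', pderiv_X, Derivation.leibniz_pow]
    rw [h]
    refine WhitneyCubic.isUnit_of_mul_eq_one' (Ideal.Quotient.mk _ (-(X 0) - X 1 * X 2 ^ 2)) ?_
    rw [← map_mul, ← (Ideal.Quotient.mk _).map_one, Ideal.Quotient.eq]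
    exact Ideal.mem_span_singleton.mpr ⟨-1, by rw [g₀']; ring⟩

/-- **Chart `c = 0`, `b = y₂`**: `g₀ ↦ y₂²·(y₁² + y₀y₁ + y₂)`, `∂₂ = 1`. [folklore] -/
theorem isRegularRing_chart₀₂ :
    IsRegularRing (blowupAlgebra ((Ideal.span (X '' CuspCone.cenVars)).map (Ideal.Quotient.mk (Ideal.span {g₀ k})))
      (Ideal.Quotient.mk (Ideal.span {g₀ k}) (X 2 : MvPolynomial (Fin 3) k))) := by
  obtain ⟨h0, h1, h2⟩ := CuspCone.subst₂_X k
  refine CuspCone.isRegularRing_strictTransformChart k (g₀ k) (g₀'' k) 2 2 ?_ ?_ ?_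
  · simp only [g₀, g₀'', map_add, map_mul, map_pow, h0, h1, h2]
    ring
  · rintro ⟨q, hq⟩
    have h := congrArg (MvPolynomial.eval ![(0 : k), 1, 0]) hq
    simp [g₀''] at h
  · refine isRegularRing_quotient_of_derivation (g₀'' k) (pderiv 2 : Derivation k (MvPolynomial (Fin 3) k) (MvPolynomial (Fin 3) k)) ?_
    have h : (pderiv 2 : Derivation k (MvPolynomial (Fin 3) k) (MvPolynomial (Fin 3) k)) (g₀'' k) = 1 := by
      simp [g₀'', pderiv_X, Derivation.leibniz_pow]
    rw [h, map_one]
    exact isUnit_one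

/-- **Chart `c = 1`, `b = y₁`**: `g₁ ↦ y₁²·(y₀ + y₂ + y₁y₂³)`, `∂₀ = 1`. [folklore] -/
theorem isRegularRing_chart₁₁ :
    IsRegularRing (blowupAlgebra ((Ideal.span (X '' CuspCone.cenVars)).map (Ideal.Quotient.mk (Ideal.span {g₁ k})))
      (Ideal.Quotient.mk (Ideal.span {g₁ k}) (X 1 : MvPolynomial (Fin 3) k))) := by
  obtain ⟨h0, h1, h2⟩ := CuspCone.subst₁_X k
  refine CuspCone.isRegularRing_strictTransformChart k (g₁ k) (g₁' k) 1 2 ?_ ?_ ?_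
  · simp only [g₁, g₁', map_add, map_mul, map_pow, h0, h1, h2]
    ring
  · rintro ⟨q, hq⟩
    have h := congrArg (MvPolynomial.eval ![(1 : k), 0, 0]) hq
    simp [g₁'] at h
  · refine isRegularRing_quotient_of_derivation (g₁' k) (pderiv 0 : Derivation k (MvPolynomial (Fin 3) k) (MvPolynomial (Fin 3) k)) ?_
    have h : (pderiv 0 : Derivation k (MvPolynomial (Fin 3) k) (MvPolynomial (Fin 3) k)) (g₁' k) = 1 := by
      simp [g₁', pderiv_X, Derivation.leibniz_pow]
    rw [h, map_one]
    exact isUnit_one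

/-- **Chart `c = 1`, `b = y₂`**: `g₁ ↦ y₂²·(y₀y₁² + y₁ + y₂)`, `∂₂ = 1`. [folklore] -/
theorem isRegularRing_chart₁₂ :
    IsRegularRing (blowupAlgebra ((Ideal.span (X '' CuspCone.cenVars)).map (Ideal.Quotient.mk (Ideal.span {g₁ k})))
      (Ideal.Quotient.mk (Ideal.span {g₁ k}) (X 2 : MvPolynomial (Fin 3) k))) := by
  obtain ⟨h0, h1, h2⟩ := CuspCone.subst₂_X k
  refine CuspCone.isRegularRing_strictTransformChart k (g₁ k) (g₁'' k) 2 2 ?_ ?_ ?_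
  · simp only [g₁, g₁'', map_add, map_mul, map_pow, h0, h1, h2]
    ring
  · rintro ⟨q, hq⟩
    have h := congrArg (MvPolynomial.eval ![(0 : k), 1, 0]) hq
    simp [g₁''] at h
  · refine isRegularRing_quotient_of_derivation (g₁'' k) (pderiv 2 : Derivation k (MvPolynomial (Fin 3) k) (MvPolynomial (Fin 3) k)) ?_
    have h : (pderiv 2 : Derivation k (MvPolynomial (Fin 3) k) (MvPolynomial (Fin 3) k)) (g₁'' k) = 1 := by
      simp [g₁'', pderiv_X, Derivation.leibniz_pow]
    rw [h, map_one]
    exact isUnit_one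

/-! ## The two charts off the double line -/

/-- **Chart `c = 2`**: `k[y]/(g₂)`, `g₂ = y₀ + y₁y₂ + y₂³`, is regular (`∂₀ g₂ = 1`). [folklore] -/
theorem isRegularRing_quotient_g₂ : IsRegularRing (MvPolynomial (Fin 3) k ⧸ Ideal.span {g₂ k}) := by
  refine isRegularRing_quotient_of_derivation (g₂ k)
    (pderiv 0 : Derivation k (MvPolynomial (Fin 3) k) (MvPolynomial (Fin 3) k)) ?_
  have h : (pderiv 0 : Derivation k (MvPolynomial (Fin 3) k) (MvPolynomial (Fin 3) k)) (g₂ k) = 1 := by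
    simp [g₂, pderiv_X, Derivation.leibniz_pow]
  rw [h, map_one]
  exact isUnit_one

/-- **Chart `c = 3`**: `k[y]/(g₃)`, `g₃ = y₀y₂² + y₁y₂ + 1`, is regular (`∂₁ g₃ = y₂`, a unit: `y₂·(−y₀y₂ − y₁) ≡ 1`). [folklore] -/
theorem isRegularRing_quotient_g₃ : IsRegularRing (MvPolynomial (Fin 3) k ⧸ Ideal.span {g₃ k}) := by
  refine isRegularRing_quotient_of_derivation (g₃ k)
    (pderiv 1 : Derivation k (MvPolynomial (Fin 3) k) (MvPolynomial (Fin 3) k)) ?_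
  have h : (pderiv 1 : Derivation k (MvPolynomial (Fin 3) k) (MvPolynomial (Fin 3) k)) (g₃ k) = X 2 := by
    simp [g₃, pderiv_X, Derivation.leibniz_pow]
  rw [h]
  refine WhitneyCubic.isUnit_of_mul_eq_one' (Ideal.Quotient.mk _ (-(X 0 * X 2) - X 1)) ?_
  rw [← map_mul, ← (Ideal.Quotient.mk _).map_one, Ideal.Quotient.eq]
  exact Ideal.mem_span_singleton.mpr ⟨-1, by rw [g₃]; ring⟩

/-- `(g₂)` is a radical ideal. [folklore] -/
theorem radical_span_g₂ : (Ideal.span {g₂ k}).radical = Ideal.span {g₂ k} := by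
  haveI := isRegularRing_quotient_g₂ k
  haveI := IsRegularRing.isReduced' (MvPolynomial (Fin 3) k ⧸ Ideal.span {g₂ k})
  exact (Ideal.isRadical_iff_quotient_reduced _).mpr inferInstance |>.radical

/-- `(g₃)` is a radical ideal. [folklore] -/
theorem radical_span_g₃ : (Ideal.span {g₃ k}).radical = Ideal.span {g₃ k} := by
  haveI := isRegularRing_quotient_g₃ k
  haveI := IsRegularRing.isReduced' (MvPolynomial (Fin 3) k ⧸ Ideal.span {g₃ k})
  exact (Ideal.isRadical_iff_quotient_reduced _).mpr inferInstance |>.radical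

/-! ## The two chart equations meeting the double line are prime -/

/-- A prime `p` not dividing `c` is relatively prime to `c` (Mathlib `Irreducible.isRelPrime_iff_not_dvd`). [folklore] -/
theorem isRelPrime_of_prime_of_not_dvd {R : Type*} [CommMonoidWithZero R] [IsCancelMulZero R] {p c : R} (hp : Prime p) (h : ¬ p ∣ c) :
    IsRelPrime p c :=
  hp.irreducible.isRelPrime_iff_not_dvd.mpr h

/-- `y₀²` and `y₀y₁ + y₁³` (in `k[y₀, y₁]`) are relatively prime (`y₀ ∤ y₁³`). [folklore] -/
theorem isRelPrime_coeff₁ : IsRelPrime (X 0 ^ 2 : MvPolynomial (Fin 2) k) (X 0 * X 1 + X 1 ^ 3) := by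
  have hp : Prime (X 0 : MvPolynomial (Fin 2) k) := X_prime
  have hnd : ¬ ((X 0 : MvPolynomial (Fin 2) k) ∣ X 0 * X 1 + X 1 ^ 3) := by
    intro h
    have h' : (X 0 : MvPolynomial (Fin 2) k) ∣ X 1 ^ 3 := (dvd_add_right (dvd_mul_right (X 0) (X 1))).mp h
    exact absurd (X_dvd_X.mp (hp.dvd_of_dvd_pow h')) (by decide)
  exact (isRelPrime_of_prime_of_not_dvd hp hnd).pow_left

/-- `y₀y₁` and `y₀² + y₁³` (in `k[y₀, y₁]`) are relatively prime (`y₀ ∤ y₁³`, `y₁ ∤ y₀²`). [folklore] -/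
theorem isRelPrime_coeff₀ : IsRelPrime (X 0 * X 1 : MvPolynomial (Fin 2) k) (X 0 ^ 2 + X 1 ^ 3) := by
  have hp0 : Prime (X 0 : MvPolynomial (Fin 2) k) := X_prime
  have hp1 : Prime (X 1 : MvPolynomial (Fin 2) k) := X_prime
  have h0 : ¬ ((X 0 : MvPolynomial (Fin 2) k) ∣ X 0 ^ 2 + X 1 ^ 3) := by
    intro h
    have h' : (X 0 : MvPolynomial (Fin 2) k) ∣ X 1 ^ 3 := (dvd_add_right (dvd_pow_self (X 0) two_ne_zero)).mp h
    exact absurd (X_dvd_X.mp (hp0.dvd_of_dvd_pow h')) (by decide)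
  have h1 : ¬ ((X 1 : MvPolynomial (Fin 2) k) ∣ X 0 ^ 2 + X 1 ^ 3) := by
    intro h
    have h' : (X 1 : MvPolynomial (Fin 2) k) ∣ X 0 ^ 2 := (dvd_add_left (dvd_pow_self (X 1) three_ne_zero)).mp h
    exact absurd (X_dvd_X.mp (hp1.dvd_of_dvd_pow h')) (by decide)
  exact (isRelPrime_of_prime_of_not_dvd hp0 h0).mul_left (isRelPrime_of_prime_of_not_dvd hp1 h1)

/-- **`g₁ = y₀y₁² + y₁y₂ + y₂³` is prime** (degree one in `y₀`: `C(y₁²)·Y + C(y₁y₂ + y₂³)`). [folklore] -/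
theorem prime_g₁ : Prime (g₁ k) := by
  have hfin : finSuccEquiv k 2 (g₁ k) = Polynomial.C (X 0 ^ 2) * Polynomial.X + Polynomial.C (X 0 * X 1 + X 1 ^ 3) := by
    have h1 : finSuccEquiv k 2 (X 1) = Polynomial.C (X 0) := finSuccEquiv_X_succ (j := 0)
    have h2 : finSuccEquiv k 2 (X 2) = Polynomial.C (X 1) := finSuccEquiv_X_succ (j := 1)
    simp only [g₁, map_add, map_mul, map_pow, finSuccEquiv_X_zero, h1, h2]
    ring
  have hirr : Irreducible (g₁ k) := by
    rw [← MulEquiv.irreducible_iff (finSuccEquiv k 2), hfin]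
    exact Polynomial.irreducible_C_mul_X_add_C (pow_ne_zero 2 (X_ne_zero 0)) (isRelPrime_coeff₁ k)
  exact UniqueFactorizationMonoid.irreducible_iff_prime.mp hirr

/-- **`g₀ = y₁² + y₀y₁y₂ + y₂³` is prime** (degree one in `y₀`: `C(y₁y₂)·Y + C(y₁² + y₂³)`). [folklore] -/
theorem prime_g₀ : Prime (g₀ k) := by
  have hfin : finSuccEquiv k 2 (g₀ k) = Polynomial.C (X 0 * X 1) * Polynomial.X + Polynomial.C (X 0 ^ 2 + X 1 ^ 3) := by
    have h1 : finSuccEquiv k 2 (X 1) = Polynomial.C (X 0) := finSuccEquiv_X_succ (j := 0)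
    have h2 : finSuccEquiv k 2 (X 2) = Polynomial.C (X 1) := finSuccEquiv_X_succ (j := 1)
    simp only [g₀, map_add, map_mul, map_pow, finSuccEquiv_X_zero, h1, h2]
    ring
  have hirr : Irreducible (g₀ k) := by
    rw [← MulEquiv.irreducible_iff (finSuccEquiv k 2), hfin]
    exact Polynomial.irreducible_C_mul_X_add_C (mul_ne_zero (X_ne_zero 0) (X_ne_zero 1)) (isRelPrime_coeff₀ k)
  exact UniqueFactorizationMonoid.irreducible_iff_prime.mp hirr

/-- `(g₁)` is a radical ideal. [folklore] -/
theorem radical_span_g₁ : (Ideal.span {g₁ k}).radical = Ideal.span {g₁ k} :=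
  ((Ideal.span_singleton_prime (prime_g₁ k).ne_zero).mpr (prime_g₁ k)).radical

/-- `(g₀)` is a radical ideal. [folklore] -/
theorem radical_span_g₀ : (Ideal.span {g₀ k}).radical = Ideal.span {g₀ k} :=
  ((Ideal.span_singleton_prime (prime_g₀ k).ne_zero).mpr (prime_g₀ k)).radical

end CayleyRuled

end Summit.ResolutionOfSingularities.ResolutionOfSingularities.Cruxes.EquisingularLiftNat.Sections

end
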